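import Summits.AtomisticToContinuum.HydrodynamicLimit.Theorems.TwoClocksEquilibriumFastWindowLDBirthT12GainRadialGeneralB
import Summits.AtomisticToContinuum.HydrodynamicLimit.Theorems.TwoClocksEquilibriumFastWindowLDBirthT12LorentzCircleAvg
import HarnessLib

/-!
# (e-K₂) on the DIPOLE sector, I: the exact one-dimensional (Carleman slice) representation of the true
# gain term on dipole fields `u(x) = ⟪a, x⟫ Θ(‖x‖)` and of its Lorentz limit
# (helper `t12_gainTerm_dipole_slice` of the line `birth`, crux `TwoClocks.EquilibriumFastWindowLD`,
# stmt-AtomisticToContinuum-14440; infrastructure (e-K₂), `ℓ = 1`, towards the registered analytic sub-goal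
# `t12_logLinearPreimage_and_dipoleModulus`, plan §5)

Dipole companion of `…T12GainRadialGeneral(B)` (the radial case `G ∘ ‖·‖`). The `ℓ = 1` step of the corrector
analysis meets dipole fields `u(x) = ⟪a, x⟫ Θ(‖x‖)` (`a ∈ ℝ³`, `Θ` the amplitude of `Π₁ψ / ‖·‖`, merely measurable
and bounded), and (e-K₂) asks for `gainTerm u v` against `lorentzGain u v` to the error `O(m‖a‖(1 + ‖v‖))`. As in
the radial case only a comparison of LAWS can work, and this file reduces both sides to ONE explicit formula.

* **Exchange symmetry** (`gainFst_eq_gainSnd`): `gainTerm u v = 2 ∫ dM(w) ∫ ((v-w)·ω)₊ u(v') dσ` — follow the OWN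
  particle `v' = v - ((v - w)·ω) ω`.
* **Carleman's slice** (`hardSphereKernel_mul_dipole_collide_fst`): with `p = ⟪v, ω⟫`, `t = ⟪w, ω⟫`, the flux is
  `(p - t)₊`, the speed `‖v'‖ = √(‖v‖² - p² + t²)` AND the linear functional `⟪a, v'⟫ = ⟪a, v⟫ - (p - t)⟪a, ω⟫`:
  given `ω`, the dipole field at `v'` sees the Maxwellian partner only through `t = ⟪w, ω⟫ ∼ γ = N(0, 1)`
  (`stdGaussian_map_inner_sphere`).
* **Hat-box and Funk–Hecke for `P₁`** (`integral_sphere_zonal_mul_inner`): for unit `n`,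
  `∫_{S²} k(⟪n, ω⟫) ⟪a, ω⟫ dσ(ω) = 2π ⟪a, n⟫ ∫_{-1}^{1} x k(x) dx` — in cylindrical coordinates about `n`
  (`t12_integral_sphere_cyl`) the transverse part `√(1-z²)(cos φ ⟪a, e₁⟫ + sin φ ⟪a, e₂⟫)` of `⟪a, ω⟫` has zero
  azimuthal average; so the `ω`-integral, no longer zonal, still reduces to `[-1, 1]` with the weights `1` and `x`.

Whence, for `Θ` measurable with `|Θ| ≤ m` on `[0, ∞)`, unit `n`, `0 ≤ S` (registered **`t12_gainTerm_dipole_slice`**):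

  `gainTerm u (S n) = 4π ⟪a, n⟫ ∫ γ(dt) J(t)`,  `J(t) := ∫_{-1}^{1} (S x - t)₊ (S - (S x - t) x) Θ(√(S² - (S x)² + t²)) dx`,

and (`lorentzGain_dipole_eq_slice`) `lorentzGain u (S n) = 4π ⟪a, n⟫ J(0) = 4π ⟪a, n⟫ ∫_{-1}^{1} (S x)₊ (S - S x²) Θ(S√(1-x²)) dx`
(`= (4π/S²) ⟪a, n⟫ ∫₀^S r³ Θ(r) dr`, the `ℓ = 1` Euler kernel of plan §5): the Lorentz operator IS the slice `t = 0`
and `gainTerm u - lorentzGain u = 4π ⟪a, n⟫ ∫ γ(dt) (J(t) - J(0))` (`gainTerm_sub_lorentzGain_dipole_eq`). The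
one-dimensional estimate `∫ γ(dt) |J(t) - J(0)| = O(m (1 + S))` is the sibling file `…T12GainDipoleB`.

[folklore] (Carleman 1933 / Hilbert 1912 representation; Funk 1916 / Hecke 1918; Grad 1963 §4;
Cercignani–Illner–Pulvirenti 1994 §7.2; (e-K₂) of the corrector-growth plan of the line `birth`).
-/

noncomputable section

open MeasureTheory ProbabilityTheory Real Set Filter Metric
open scoped ENNReal BigOperators InnerProductSpace
namespace Summit.AtomisticToContinuum.HydrodynamicLimit.Theorems.ClampedCorrectorBirth

open Literature.Analysis.FluidPDE Literature.MathematicalPhysics.KineticTheory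
open Literature.Analysis.UnboundedOperators Literature.Probability.Distributions

variable {Θ : ℝ → ℝ} {m : ℝ} {v : EuclideanSpace ℝ (Fin 3)}

/-! ### Carleman's slice of the dipole field along the own particle -/

/-- The linear functional `⟪a, ·⟫` of the own outgoing velocity: `⟪a, v'⟫ = ⟪a, v⟫ - (⟪v, ω⟫ - ⟪w, ω⟫) ⟪a, ω⟫`
(`v' = v - ((v - w)·ω) ω`). [folklore] -/
theorem inner_collide_fst (a v w : EuclideanSpace ℝ (Fin 3)) (ω : sphere (0 : EuclideanSpace ℝ (Fin 3)) 1) :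
    ⟪a, (collide ω (v, w)).1⟫_ℝ = ⟪a, v⟫_ℝ - (⟪v, ω⟫_ℝ - ⟪w, ω⟫_ℝ) * ⟪a, ω⟫_ℝ := by
  simp only [collide, inner_sub_right, real_inner_smul_right, inner_sub_left]

/-- **Carleman's slice of the dipole field along the own particle**: with `p = ⟪v, ω⟫`, `t = ⟪w, ω⟫`,
`((v - w)·ω)₊ ⟪a, v'⟫ Θ(‖v'‖) = (p - t)₊ (⟪a, v⟫ - (p - t)⟪a, ω⟫) Θ(√(‖v‖² - p² + t²))` — given the impact
direction, the dipole field at the own outgoing velocity sees the partner only through `t`. [folklore] -/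
theorem hardSphereKernel_mul_dipole_collide_fst (a : EuclideanSpace ℝ (Fin 3)) (Θ : ℝ → ℝ)
    (v w : EuclideanSpace ℝ (Fin 3)) (ω : sphere (0 : EuclideanSpace ℝ (Fin 3)) 1) :
    hardSphereKernel (v, w) ω * (⟪a, (collide ω (v, w)).1⟫_ℝ * Θ ‖(collide ω (v, w)).1‖) =
      max (⟪v, ω⟫_ℝ - ⟪w, ω⟫_ℝ) 0 * ((⟪a, v⟫_ℝ - (⟪v, ω⟫_ℝ - ⟪w, ω⟫_ℝ) * ⟪a, ω⟫_ℝ) *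
        Θ (√(‖v‖ ^ 2 - ⟪v, ω⟫_ℝ ^ 2 + ⟪w, ω⟫_ℝ ^ 2))) := by
  rw [mul_left_comm, hardSphereKernel_mul_comp_norm_collide_fst Θ v w ω, inner_collide_fst]
  ring

/-- `‖v - (⟪v, ω⟫ - t) ω‖ = √(‖v‖² - ⟪v, ω⟫² + t²)` for `ω ∈ S²` and every real `t`. [folklore] -/
theorem norm_sub_smul_sphere (v : EuclideanSpace ℝ (Fin 3)) (ω : sphere (0 : EuclideanSpace ℝ (Fin 3)) 1) (t : ℝ) :
    ‖v - (⟪v, ω⟫_ℝ - t) • (ω : EuclideanSpace ℝ (Fin 3))‖ = √(‖v‖ ^ 2 - ⟪v, ω⟫_ℝ ^ 2 + t ^ 2) := by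
  have hsq : ‖v - (⟪v, ω⟫_ℝ - t) • (ω : EuclideanSpace ℝ (Fin 3))‖ ^ 2 = ‖v‖ ^ 2 - ⟪v, ω⟫_ℝ ^ 2 + t ^ 2 := by
    rw [norm_sub_sq_real, real_inner_smul_right, norm_smul, norm_eq_of_mem_sphere, mul_one, Real.norm_eq_abs,
      sq_abs]
    ring
  rw [← hsq, Real.sqrt_sq (norm_nonneg _)]

/-- The dipole amplitude of the slice is at most `‖a‖` times the outgoing speed:
`|⟪a, v⟫ - (⟪v, ω⟫ - t)⟪a, ω⟫| ≤ ‖a‖ √(‖v‖² - ⟪v, ω⟫² + t²)` (it is `⟪a, v - (⟪v, ω⟫ - t) ω⟫`). [folklore] -/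
theorem abs_dipole_amplitude_le (a v : EuclideanSpace ℝ (Fin 3)) (ω : sphere (0 : EuclideanSpace ℝ (Fin 3)) 1) (t : ℝ) :
    |⟪a, v⟫_ℝ - (⟪v, ω⟫_ℝ - t) * ⟪a, ω⟫_ℝ| ≤ ‖a‖ * √(‖v‖ ^ 2 - ⟪v, ω⟫_ℝ ^ 2 + t ^ 2) := by
  have h : ⟪a, v⟫_ℝ - (⟪v, ω⟫_ℝ - t) * ⟪a, ω⟫_ℝ = ⟪a, v - (⟪v, ω⟫_ℝ - t) • (ω : EuclideanSpace ℝ (Fin 3))⟫_ℝ := by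
    rw [inner_sub_right, real_inner_smul_right]
  rw [h, ← norm_sub_smul_sphere v ω t]
  exact abs_real_inner_le_norm _ _

/-- A dipole field with bounded amplitude has linear growth: `|⟪a, x⟫ Θ(‖x‖)| ≤ ‖a‖ (m ‖x‖)`. [folklore] -/
theorem abs_dipole_le (hm : ∀ t : ℝ, 0 ≤ t → |Θ t| ≤ m) (a x : EuclideanSpace ℝ (Fin 3)) :
    |⟪a, x⟫_ℝ * Θ ‖x‖| ≤ ‖a‖ * (m * ‖x‖) := by
  rw [abs_mul]
  calc |⟪a, x⟫_ℝ| * |Θ ‖x‖| ≤ (‖a‖ * ‖x‖) * m :=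
        mul_le_mul (abs_real_inner_le_norm a x) (hm _ (norm_nonneg x)) (abs_nonneg _) (by positivity)
    _ = ‖a‖ * (m * ‖x‖) := by ring

/-- Bounded amplitude `|Θ| ≤ m` on `[0, ∞)` forces `0 ≤ m` and the linear growth `|m t| ≤ m (1 + t)` of the
comparison weight `t ↦ m t`. [folklore] -/
theorem linearGrowth_of_bounded (hm : ∀ t : ℝ, 0 ≤ t → |Θ t| ≤ m) :
    0 ≤ m ∧ ∀ t : ℝ, 0 ≤ t → |m * t| ≤ m * (1 + t) := by
  have hm0 : 0 ≤ m := (abs_nonneg _).trans (hm 0 le_rfl)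
  refine ⟨hm0, fun t ht => ?_⟩
  rw [abs_of_nonneg (mul_nonneg hm0 ht)]
  nlinarith

/-! ### Integrability on the two product spaces (domination by the radial weight `m ‖·‖`) -/

/-- **Integrability of the own-particle dipole integrand on `M ⊗ σ`**: `(w, ω) ↦ ((v - w)·ω)₊ ⟪a, v'⟫ Θ(‖v'‖)` is
integrable for `Θ` measurable and bounded (dominated by `‖a‖` times the radial integrand of the weight `m ‖·‖`,
`integrable_gainFst_radial_prod`). [folklore] -/
theorem integrable_gainFst_dipole_prod (a : EuclideanSpace ℝ (Fin 3)) (hΘ : Measurable Θ)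
    (hm : ∀ t : ℝ, 0 ≤ t → |Θ t| ≤ m) (v : EuclideanSpace ℝ (Fin 3)) :
    Integrable (Function.uncurry fun (w : EuclideanSpace ℝ (Fin 3)) (ω : sphere (0 : EuclideanSpace ℝ (Fin 3)) 1) =>
        hardSphereKernel (v, w) ω * (⟪a, (collide ω (v, w)).1⟫_ℝ * Θ ‖(collide ω (v, w)).1‖))
      ((stdGaussian (EuclideanSpace ℝ (Fin 3))).prod (sphereMeasure : Measure (sphere (0 : EuclideanSpace ℝ (Fin 3)) 1))) := by
  obtain ⟨_, hlin⟩ := linearGrowth_of_bounded hm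
  have h := ((integrable_gainFst_radial_prod (G := fun t => m * t) (by fun_prop) hlin v).norm.const_mul ‖a‖)
  have hB : Continuous fun p : EuclideanSpace ℝ (Fin 3) × sphere (0 : EuclideanSpace ℝ (Fin 3)) 1 =>
      hardSphereKernel (v, p.1) p.2 := by unfold hardSphereKernel; fun_prop
  have hC : Continuous fun p : EuclideanSpace ℝ (Fin 3) × sphere (0 : EuclideanSpace ℝ (Fin 3)) 1 =>
      (collide p.2 (v, p.1)).1 := by unfold collide; fun_prop
  refine h.mono' (hB.measurable.mul ((measurable_const.inner hC.measurable).mul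
    (hΘ.comp hC.norm.measurable))).aestronglyMeasurable (Eventually.of_forall fun p => ?_)
  rcases p with ⟨w, ω⟩
  simp only [Function.uncurry_apply_pair, Real.norm_eq_abs]
  calc |hardSphereKernel (v, w) ω * (⟪a, (collide ω (v, w)).1⟫_ℝ * Θ ‖(collide ω (v, w)).1‖)|
      = |hardSphereKernel (v, w) ω| * |⟪a, (collide ω (v, w)).1⟫_ℝ * Θ ‖(collide ω (v, w)).1‖| := abs_mul _ _
    _ ≤ |hardSphereKernel (v, w) ω| * (‖a‖ * (m * ‖(collide ω (v, w)).1‖)) :=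
        mul_le_mul_of_nonneg_left (abs_dipole_le hm a _) (abs_nonneg _)
    _ = ‖a‖ * |hardSphereKernel (v, w) ω * (m * ‖(collide ω (v, w)).1‖)| := by
        rw [abs_mul, abs_of_nonneg (by positivity : (0:ℝ) ≤ m * ‖(collide ω (v, w)).1‖)]
        ring

/-- **Integrability of the dipole slice integrand on `σ ⊗ γ`**:
`(ω, t) ↦ (⟪v, ω⟫ - t)₊ (⟪a, v⟫ - (⟪v, ω⟫ - t)⟪a, ω⟫) Θ(√(‖v‖² - ⟪v, ω⟫² + t²))` is integrable for `Θ` measurable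
and bounded (dominated by `‖a‖` times the radial slice integrand of the weight `m ‖·‖`, `integrable_slice_prod`). [folklore] -/
theorem integrable_dipole_slice_prod (a : EuclideanSpace ℝ (Fin 3)) (hΘ : Measurable Θ)
    (hm : ∀ t : ℝ, 0 ≤ t → |Θ t| ≤ m) (v : EuclideanSpace ℝ (Fin 3)) :
    Integrable (Function.uncurry fun (ω : sphere (0 : EuclideanSpace ℝ (Fin 3)) 1) (t : ℝ) => max (⟪v, ω⟫_ℝ - t) 0 *
        ((⟪a, v⟫_ℝ - (⟪v, ω⟫_ℝ - t) * ⟪a, ω⟫_ℝ) * Θ (√(‖v‖ ^ 2 - ⟪v, ω⟫_ℝ ^ 2 + t ^ 2))))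
      ((sphereMeasure : Measure (sphere (0 : EuclideanSpace ℝ (Fin 3)) 1)).prod (gaussianReal 0 1)) := by
  obtain ⟨hm0, hlin⟩ := linearGrowth_of_bounded hm
  have h := ((integrable_slice_prod (G := fun t => m * t) (by fun_prop) hlin v).norm.const_mul ‖a‖)
  have hmeas : Measurable (Function.uncurry fun (ω : sphere (0 : EuclideanSpace ℝ (Fin 3)) 1) (t : ℝ) =>
      max (⟪v, ω⟫_ℝ - t) 0 * ((⟪a, v⟫_ℝ - (⟪v, ω⟫_ℝ - t) * ⟪a, ω⟫_ℝ) * Θ (√(‖v‖ ^ 2 - ⟪v, ω⟫_ℝ ^ 2 + t ^ 2)))) := by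
    refine Measurable.mul (by fun_prop) (Measurable.mul (by fun_prop) (hΘ.comp ?_))
    fun_prop
  refine h.mono' hmeas.aestronglyMeasurable (Eventually.of_forall fun p => ?_)
  rcases p with ⟨ω, t⟩
  simp only [Function.uncurry_apply_pair, Real.norm_eq_abs]
  rw [abs_mul, abs_mul, abs_mul, abs_of_nonneg (le_max_right _ _),
    abs_of_nonneg (by positivity : (0:ℝ) ≤ m * √(‖v‖ ^ 2 - ⟪v, ω⟫_ℝ ^ 2 + t ^ 2))]
  calc max (⟪v, ω⟫_ℝ - t) 0 * (|⟪a, v⟫_ℝ - (⟪v, ω⟫_ℝ - t) * ⟪a, ω⟫_ℝ| * |Θ (√(‖v‖ ^ 2 - ⟪v, ω⟫_ℝ ^ 2 + t ^ 2))|)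
      ≤ max (⟪v, ω⟫_ℝ - t) 0 * ((‖a‖ * √(‖v‖ ^ 2 - ⟪v, ω⟫_ℝ ^ 2 + t ^ 2)) * m) :=
        mul_le_mul_of_nonneg_left (mul_le_mul (abs_dipole_amplitude_le a v ω t) (hm _ (sqrt_nonneg _))
          (abs_nonneg _) (by positivity)) (le_max_right _ _)
    _ = ‖a‖ * (max (⟪v, ω⟫_ℝ - t) 0 * (m * √(‖v‖ ^ 2 - ⟪v, ω⟫_ℝ ^ 2 + t ^ 2))) := by ring

/-! ### Funk–Hecke for `P₁`: a zonal weight against the linear profile `⟪a, ·⟫` -/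

/-- The azimuthal integral of an affine function of `(cos φ, sin φ)` over a full period:
`∫_{-π}^{π} (c₀ + s (c₁ cos φ + c₂ sin φ)) dφ = 2π c₀`. [folklore] -/
theorem integral_azimuth_affine (c₀ s c₁ c₂ : ℝ) :
    ∫ φ in (-π)..π, (c₀ + s * (cos φ * c₁ + sin φ * c₂)) = 2 * π * c₀ := by
  have i1 : IntervalIntegrable (fun φ => cos φ * c₁) volume (-π) π :=
    (continuous_cos.mul continuous_const).intervalIntegrable _ _
  have i2 : IntervalIntegrable (fun φ => sin φ * c₂) volume (-π) π :=
    (continuous_sin.mul continuous_const).intervalIntegrable _ _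
  rw [intervalIntegral.integral_add intervalIntegrable_const ((i1.add i2).const_mul s),
    intervalIntegral.integral_const, intervalIntegral.integral_const_mul, intervalIntegral.integral_add i1 i2,
    intervalIntegral.integral_mul_const, intervalIntegral.integral_mul_const, integral_cos, integral_sin,
    sin_neg, sin_pi, cos_neg, smul_eq_mul]
  ring

/-- **Funk–Hecke for `P₁`**: for a unit vector `n`, every `a ∈ ℝ³` and `k` measurable and integrable on
`[-1, 1]`: `∫_{S²} k(⟪n, ν⟫) ⟪a, ν⟫ dσ(ν) = 2π ⟪a, n⟫ ∫_{-1}^{1} x k(x) dx` — a zonal weight sees only the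
component of `a` along the axis (cylindrical coordinates `t12_integral_sphere_cyl`: the transverse part
`√(1-z²)(cos φ ⟪a, e₁⟫ + sin φ ⟪a, e₂⟫)` has zero azimuthal average). [folklore] -/
theorem integral_sphere_zonal_mul_inner {n : EuclideanSpace ℝ (Fin 3)} (hn : ‖n‖ = 1) (a : EuclideanSpace ℝ (Fin 3))
    {k : ℝ → ℝ} (hk : Measurable k) (hki : IntervalIntegrable k volume (-1) 1) :
    ∫ ν : sphere (0 : EuclideanSpace ℝ (Fin 3)) 1, k ⟪n, ν⟫_ℝ * ⟪a, ν⟫_ℝ ∂sphereMeasure =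
      2 * π * ⟪a, n⟫_ℝ * ∫ x in (-1:ℝ)..1, x * k x := by
  have hY : Measurable fun x : EuclideanSpace ℝ (Fin 3) => ⟪a, x⟫_ℝ := measurable_const.inner measurable_id
  have hi := integrable_sphere_zonal_mul hn hki hY (m := ‖a‖) fun x hx => by
    have h := abs_real_inner_le_norm a x
    rwa [hx, mul_one] at h
  rw [integral_sphere_zonal_mul_eq_intervalIntegral hn hk hY hi]
  have hinner : ∀ z φ : ℝ,
      ⟪a, z • n + √(1 - z ^ 2) • (cos φ • Lambert.e₁ n + sin φ • Lambert.e₂ n)⟫_ℝ =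
        z * ⟪a, n⟫_ℝ + √(1 - z ^ 2) * (cos φ * ⟪a, Lambert.e₁ n⟫_ℝ + sin φ * ⟪a, Lambert.e₂ n⟫_ℝ) := fun z φ => by
    simp only [inner_add_right, real_inner_smul_right]
  simp_rw [hinner, integral_azimuth_affine]
  rw [← intervalIntegral.integral_const_mul]
  refine intervalIntegral.integral_congr fun x _ => ?_
  ring

/-! ### The slice on the sphere: hat-box and Funk–Hecke -/

/-- **The `t`-slice of the dipole field on the sphere**: for unit `n` with `⟪v, ·⟫ = ‖v‖ ⟪n, ·⟫`, `S = ‖v‖` and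
every real `t`,
`∫_{S²} (⟪v, ω⟫ - t)₊ (⟪a, v⟫ - (⟪v, ω⟫ - t)⟪a, ω⟫) Θ(√(S² - ⟪v, ω⟫² + t²)) dσ(ω)`
`= 2π ⟪a, n⟫ ∫_{-1}^{1} (S x - t)₊ (S - (S x - t) x) Θ(√(S² - (S x)² + t²)) dx`
(hat-box law for the term `⟪a, v⟫ = S⟪a, n⟫`, Funk–Hecke for `P₁` for the term `⟪a, ω⟫`). [folklore] -/
theorem sphereIntegral_dipole_slice_eq (a : EuclideanSpace ℝ (Fin 3)) (hΘ : Measurable Θ)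
    (hm : ∀ t : ℝ, 0 ≤ t → |Θ t| ≤ m) {n : EuclideanSpace ℝ (Fin 3)} (hn : ‖n‖ = 1)
    (hvn : ∀ x : EuclideanSpace ℝ (Fin 3), ⟪v, x⟫_ℝ = ‖v‖ * ⟪n, x⟫_ℝ) (t : ℝ) :
    ∫ ω : sphere (0 : EuclideanSpace ℝ (Fin 3)) 1, max (⟪v, ω⟫_ℝ - t) 0 *
        ((⟪a, v⟫_ℝ - (⟪v, ω⟫_ℝ - t) * ⟪a, ω⟫_ℝ) * Θ (√(‖v‖ ^ 2 - ⟪v, ω⟫_ℝ ^ 2 + t ^ 2))) ∂sphereMeasure =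
      2 * π * ⟪a, n⟫_ℝ * ∫ x in (-1:ℝ)..1,
        max (‖v‖ * x - t) 0 * (‖v‖ - (‖v‖ * x - t) * x) * Θ (√(‖v‖ ^ 2 - (‖v‖ * x) ^ 2 + t ^ 2)) := by
  have hm0 : 0 ≤ m := (linearGrowth_of_bounded hm).1
  have hav : ⟪a, v⟫_ℝ = ‖v‖ * ⟪a, n⟫_ℝ := by rw [real_inner_comm, hvn, real_inner_comm]
  have hΘb : ∀ x : ℝ, |Θ (√(‖v‖ ^ 2 - (‖v‖ * x) ^ 2 + t ^ 2))| ≤ m := fun x => hm _ (sqrt_nonneg _)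
  have hpos : ∀ x ∈ uIoc (-1:ℝ) 1, |max (‖v‖ * x - t) 0| ≤ ‖v‖ + |t| := fun x hx => by
    rw [uIoc_of_le (by norm_num)] at hx
    rw [abs_of_nonneg (le_max_right _ _)]
    exact max_le (by nlinarith [hx.2, neg_abs_le t, norm_nonneg v]) (by positivity)
  have J1 : IntervalIntegrable (fun x => max (‖v‖ * x - t) 0 * Θ (√(‖v‖ ^ 2 - (‖v‖ * x) ^ 2 + t ^ 2)))
      volume (-1) 1 := by
    refine intervalIntegrable_of_abs_le (by fun_prop) (C := (‖v‖ + |t|) * m) fun x hx => ?_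
    rw [abs_mul]
    exact mul_le_mul (hpos x hx) (hΘb x) (abs_nonneg _) (by positivity)
  have J2 : IntervalIntegrable (fun x => max (‖v‖ * x - t) 0 * (‖v‖ * x - t) *
      Θ (√(‖v‖ ^ 2 - (‖v‖ * x) ^ 2 + t ^ 2))) volume (-1) 1 := by
    refine intervalIntegrable_of_abs_le (by fun_prop) (C := (‖v‖ + |t|) * (‖v‖ + |t|) * m) fun x hx => ?_
    rw [abs_mul, abs_mul]
    refine mul_le_mul (mul_le_mul (hpos x hx) ?_ (abs_nonneg _) (by positivity)) (hΘb x) (abs_nonneg _)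
      (by positivity)
    rw [uIoc_of_le (by norm_num)] at hx
    exact (abs_sub _ _).trans (add_le_add (by rw [abs_mul, abs_norm]; nlinarith [abs_le.2 ⟨hx.1.le, hx.2⟩, norm_nonneg v]) le_rfl)
  have I1 : Integrable (fun ω : sphere (0 : EuclideanSpace ℝ (Fin 3)) 1 => ‖v‖ * ⟪a, n⟫_ℝ *
      (max (‖v‖ * ⟪n, ω⟫_ℝ - t) 0 * Θ (√(‖v‖ ^ 2 - (‖v‖ * ⟪n, ω⟫_ℝ) ^ 2 + t ^ 2)))) sphereMeasure :=
    (integrable_sphere_comp_inner_of_intervalIntegrable hn J1).const_mul _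
  have I2 : Integrable (fun ω : sphere (0 : EuclideanSpace ℝ (Fin 3)) 1 =>
      (max (‖v‖ * ⟪n, ω⟫_ℝ - t) 0 * (‖v‖ * ⟪n, ω⟫_ℝ - t) * Θ (√(‖v‖ ^ 2 - (‖v‖ * ⟪n, ω⟫_ℝ) ^ 2 + t ^ 2))) *
        ⟪a, ω⟫_ℝ) sphereMeasure :=
    integrable_sphere_zonal_mul hn J2 (measurable_const.inner measurable_id) (m := ‖a‖) fun x hx => by
      have h := abs_real_inner_le_norm a x
      rwa [hx, mul_one] at h
  have hsplit : ∀ ω : sphere (0 : EuclideanSpace ℝ (Fin 3)) 1, max (⟪v, ω⟫_ℝ - t) 0 *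
        ((⟪a, v⟫_ℝ - (⟪v, ω⟫_ℝ - t) * ⟪a, ω⟫_ℝ) * Θ (√(‖v‖ ^ 2 - ⟪v, ω⟫_ℝ ^ 2 + t ^ 2))) =
      ‖v‖ * ⟪a, n⟫_ℝ * (max (‖v‖ * ⟪n, ω⟫_ℝ - t) 0 * Θ (√(‖v‖ ^ 2 - (‖v‖ * ⟪n, ω⟫_ℝ) ^ 2 + t ^ 2))) -
        (max (‖v‖ * ⟪n, ω⟫_ℝ - t) 0 * (‖v‖ * ⟪n, ω⟫_ℝ - t) * Θ (√(‖v‖ ^ 2 - (‖v‖ * ⟪n, ω⟫_ℝ) ^ 2 + t ^ 2))) *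
          ⟪a, ω⟫_ℝ := fun ω => by
    rw [hvn, hav]; ring
  have hcomb : (∫ x in (-1:ℝ)..1,
      max (‖v‖ * x - t) 0 * (‖v‖ - (‖v‖ * x - t) * x) * Θ (√(‖v‖ ^ 2 - (‖v‖ * x) ^ 2 + t ^ 2))) =
      ‖v‖ * (∫ x in (-1:ℝ)..1, max (‖v‖ * x - t) 0 * Θ (√(‖v‖ ^ 2 - (‖v‖ * x) ^ 2 + t ^ 2))) -
        ∫ x in (-1:ℝ)..1, x * (max (‖v‖ * x - t) 0 * (‖v‖ * x - t) * Θ (√(‖v‖ ^ 2 - (‖v‖ * x) ^ 2 + t ^ 2))) := by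
    have J3 : IntervalIntegrable (fun x => x * (max (‖v‖ * x - t) 0 * (‖v‖ * x - t) *
        Θ (√(‖v‖ ^ 2 - (‖v‖ * x) ^ 2 + t ^ 2)))) volume (-1) 1 := J2.continuousOn_mul continuousOn_id
    rw [← intervalIntegral.integral_const_mul, ← intervalIntegral.integral_sub (J1.const_mul _) J3]
    refine intervalIntegral.integral_congr fun x _ => ?_
    ring
  simp_rw [hsplit]
  rw [integral_sub I1 I2, integral_const_mul,
    integral_sphere_comp_inner_real hn (g := fun x => max (‖v‖ * x - t) 0 * Θ (√(‖v‖ ^ 2 - (‖v‖ * x) ^ 2 + t ^ 2)))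
      (Measurable.aestronglyMeasurable (by fun_prop)),
    integral_sphere_zonal_mul_inner hn a (by fun_prop) J2, hcomb]
  ring

/-! ### The exact slice representation of the own piece, of the gain term and of the Lorentz operator -/

/-- **The own piece of the dipole field in slice form**: for `Θ` measurable and bounded on `[0, ∞)`, unit `n` with
`⟪v, ·⟫ = ‖v‖⟪n, ·⟫` and `S = ‖v‖`,
`∫ dM(w) ∫_{S²} ((v - w)·ω)₊ ⟪a, v'⟫ Θ(‖v'‖) dσ(ω) = 2π ⟪a, n⟫ ∫ γ(dt) ∫_{-1}^{1} (S x - t)₊ (S - (S x - t) x) Θ(√(S² - (S x)² + t²)) dx`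
(Fubini on `M ⊗ σ`, the Gaussian projection `t = ⟪w, ω⟫ ∼ γ`, Fubini on `σ ⊗ γ`, hat-box and Funk–Hecke). [folklore] -/
theorem gainFst_dipole_eq_slice (a : EuclideanSpace ℝ (Fin 3)) (hΘ : Measurable Θ)
    (hm : ∀ t : ℝ, 0 ≤ t → |Θ t| ≤ m) {n : EuclideanSpace ℝ (Fin 3)} (hn : ‖n‖ = 1)
    (hvn : ∀ x : EuclideanSpace ℝ (Fin 3), ⟪v, x⟫_ℝ = ‖v‖ * ⟪n, x⟫_ℝ) :
    ∫ w, ∫ ω, hardSphereKernel (v, w) ω * (⟪a, (collide ω (v, w)).1⟫_ℝ * Θ ‖(collide ω (v, w)).1‖) ∂sphereMeasure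
        ∂stdGaussian (EuclideanSpace ℝ (Fin 3)) =
      2 * π * ⟪a, n⟫_ℝ * ∫ t, (∫ x in (-1:ℝ)..1,
        max (‖v‖ * x - t) 0 * (‖v‖ - (‖v‖ * x - t) * x) * Θ (√(‖v‖ ^ 2 - (‖v‖ * x) ^ 2 + t ^ 2))) ∂gaussianReal 0 1 := by
  haveI := isFiniteMeasure_sphereMeasure (E := EuclideanSpace ℝ (Fin 3))
  calc ∫ w, ∫ ω, hardSphereKernel (v, w) ω * (⟪a, (collide ω (v, w)).1⟫_ℝ * Θ ‖(collide ω (v, w)).1‖) ∂sphereMeasure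
          ∂stdGaussian (EuclideanSpace ℝ (Fin 3))
      = ∫ ω, ∫ w, hardSphereKernel (v, w) ω * (⟪a, (collide ω (v, w)).1⟫_ℝ * Θ ‖(collide ω (v, w)).1‖)
          ∂stdGaussian (EuclideanSpace ℝ (Fin 3)) ∂sphereMeasure :=
        integral_integral_swap (integrable_gainFst_dipole_prod a hΘ hm v)
    _ = ∫ ω : sphere (0 : EuclideanSpace ℝ (Fin 3)) 1, ∫ t, max (⟪v, ω⟫_ℝ - t) 0 *
          ((⟪a, v⟫_ℝ - (⟪v, ω⟫_ℝ - t) * ⟪a, ω⟫_ℝ) * Θ (√(‖v‖ ^ 2 - ⟪v, ω⟫_ℝ ^ 2 + t ^ 2)))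
            ∂gaussianReal 0 1 ∂sphereMeasure := by
        refine integral_congr_ae (Eventually.of_forall fun ω => ?_)
        dsimp only
        simp_rw [hardSphereKernel_mul_dipole_collide_fst]
        exact integral_stdGaussian_comp_inner_sphere ω (h := fun t => max (⟪v, ω⟫_ℝ - t) 0 *
          ((⟪a, v⟫_ℝ - (⟪v, ω⟫_ℝ - t) * ⟪a, ω⟫_ℝ) * Θ (√(‖v‖ ^ 2 - ⟪v, ω⟫_ℝ ^ 2 + t ^ 2)))) (by fun_prop)
    _ = ∫ t, ∫ ω : sphere (0 : EuclideanSpace ℝ (Fin 3)) 1, max (⟪v, ω⟫_ℝ - t) 0 *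
          ((⟪a, v⟫_ℝ - (⟪v, ω⟫_ℝ - t) * ⟪a, ω⟫_ℝ) * Θ (√(‖v‖ ^ 2 - ⟪v, ω⟫_ℝ ^ 2 + t ^ 2)))
            ∂sphereMeasure ∂gaussianReal 0 1 :=
        integral_integral_swap (integrable_dipole_slice_prod a hΘ hm v)
    _ = ∫ t, 2 * π * ⟪a, n⟫_ℝ * (∫ x in (-1:ℝ)..1,
          max (‖v‖ * x - t) 0 * (‖v‖ - (‖v‖ * x - t) * x) * Θ (√(‖v‖ ^ 2 - (‖v‖ * x) ^ 2 + t ^ 2))) ∂gaussianReal 0 1 :=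
        integral_congr_ae (Eventually.of_forall fun t => sphereIntegral_dipole_slice_eq a hΘ hm hn hvn t)
    _ = _ := integral_const_mul _ _

/-- **The dipole slice is `γ`-integrable**: `t ↦ ∫_{-1}^{1} (S x - t)₊ (S - (S x - t) x) Θ(√(S² - (S x)² + t²)) dx ∈ L¹(γ)`
for `Θ` measurable and bounded on `[0, ∞)` (`S = ‖v‖`; the slice of the field with `a = n`). [folklore] -/
theorem integrable_dipole_slice (hΘ : Measurable Θ) (hm : ∀ t : ℝ, 0 ≤ t → |Θ t| ≤ m) (v : EuclideanSpace ℝ (Fin 3)) :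
    Integrable (fun t => ∫ x in (-1:ℝ)..1,
      max (‖v‖ * x - t) 0 * (‖v‖ - (‖v‖ * x - t) * x) * Θ (√(‖v‖ ^ 2 - (‖v‖ * x) ^ 2 + t ^ 2))) (gaussianReal 0 1) := by
  haveI := isFiniteMeasure_sphereMeasure (E := EuclideanSpace ℝ (Fin 3))
  obtain ⟨n, hn, hvn⟩ := exists_unit_inner_eq v
  have h := ((integrable_dipole_slice_prod n hΘ hm v).integral_prod_right).congr
    (Eventually.of_forall fun t => sphereIntegral_dipole_slice_eq n hΘ hm hn hvn t)
  have hnn : ⟪n, n⟫_ℝ = 1 := by rw [real_inner_self_eq_norm_sq, hn, one_pow]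
  refine (h.const_mul (2 * π)⁻¹).congr (Eventually.of_forall fun t => ?_)
  dsimp only
  rw [hnn, mul_one, ← mul_assoc, inv_mul_cancel₀ (by positivity), one_mul]

/-- **The true gain term on dipole fields in slice form**: for `Θ` measurable and bounded on `[0, ∞)`, unit `n` with
`⟪v, ·⟫ = ‖v‖⟪n, ·⟫`, `S = ‖v‖`:
`gainTerm (⟪a, ·⟫ Θ(‖·‖)) v = 4π ⟪a, n⟫ ∫ γ(dt) ∫_{-1}^{1} (S x - t)₊ (S - (S x - t) x) Θ(√(S² - (S x)² + t²)) dx`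
(exchange symmetry: twice the own piece). [folklore] -/
theorem gainTerm_dipole_eq_slice (a : EuclideanSpace ℝ (Fin 3)) (hΘ : Measurable Θ)
    (hm : ∀ t : ℝ, 0 ≤ t → |Θ t| ≤ m) {n : EuclideanSpace ℝ (Fin 3)} (hn : ‖n‖ = 1)
    (hvn : ∀ x : EuclideanSpace ℝ (Fin 3), ⟪v, x⟫_ℝ = ‖v‖ * ⟪n, x⟫_ℝ) :
    gainTerm (fun x => ⟪a, x⟫_ℝ * Θ ‖x‖) v = 4 * π * ⟪a, n⟫_ℝ * ∫ t, (∫ x in (-1:ℝ)..1,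
      max (‖v‖ * x - t) 0 * (‖v‖ - (‖v‖ * x - t) * x) * Θ (√(‖v‖ ^ 2 - (‖v‖ * x) ^ 2 + t ^ 2))) ∂gaussianReal 0 1 := by
  have hu : Measurable fun x : EuclideanSpace ℝ (Fin 3) => ⟪a, x⟫_ℝ * Θ ‖x‖ := by fun_prop
  have h2 : ∫ w, ∫ ω, hardSphereKernel (v, w) ω * (⟪a, (collide ω (v, w)).2⟫_ℝ * Θ ‖(collide ω (v, w)).2‖)
        ∂sphereMeasure ∂stdGaussian (EuclideanSpace ℝ (Fin 3)) =
      ∫ w, ∫ ω, hardSphereKernel (v, w) ω * (⟪a, (collide ω (v, w)).1⟫_ℝ * Θ ‖(collide ω (v, w)).1‖)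
        ∂sphereMeasure ∂stdGaussian (EuclideanSpace ℝ (Fin 3)) :=
    integral_congr_ae (Eventually.of_forall fun w => (gainFst_eq_gainSnd v w hu).symm)
  simp only [gainTerm]
  rw [h2, gainFst_dipole_eq_slice a hΘ hm hn hvn]
  ring

/-- **The Lorentz operator on dipole fields is the slice `t = 0`**: for `Θ` measurable and bounded on `[0, ∞)`,
unit `n` with `⟪v, ·⟫ = ‖v‖⟪n, ·⟫`, `S = ‖v‖`:
`lorentzGain (⟪a, ·⟫ Θ(‖·‖)) v = 4π ⟪a, n⟫ ∫_{-1}^{1} (S x)₊ (S - S x²) Θ(√(S² - (S x)²)) dx` (partner at rest,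
`t = ⟪0, ω⟫ = 0`; `= 4π ⟪a, n⟫ S² ∫₀¹ x (1 - x²) Θ(S√(1 - x²)) dx = (4π/S²) ⟪a, n⟫ ∫₀^S r³ Θ(r) dr`). [folklore] -/
theorem lorentzGain_dipole_eq_slice (a : EuclideanSpace ℝ (Fin 3)) (hΘ : Measurable Θ)
    (hm : ∀ t : ℝ, 0 ≤ t → |Θ t| ≤ m) {n : EuclideanSpace ℝ (Fin 3)} (hn : ‖n‖ = 1)
    (hvn : ∀ x : EuclideanSpace ℝ (Fin 3), ⟪v, x⟫_ℝ = ‖v‖ * ⟪n, x⟫_ℝ) :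
    lorentzGain (fun x => ⟪a, x⟫_ℝ * Θ ‖x‖) v = 4 * π * ⟪a, n⟫_ℝ * ∫ x in (-1:ℝ)..1,
      max (‖v‖ * x) 0 * (‖v‖ - ‖v‖ * x * x) * Θ (√(‖v‖ ^ 2 - (‖v‖ * x) ^ 2)) := by
  have hu : Measurable fun x : EuclideanSpace ℝ (Fin 3) => ⟪a, x⟫_ℝ * Θ ‖x‖ := by fun_prop
  have h0 := gain_zero_eq_lorentzGain v hu
  have h1 := gainFst_eq_gainSnd v 0 hu
  have h3 : ∫ ω, hardSphereKernel (v, 0) ω * (⟪a, (collide ω (v, 0)).1⟫_ℝ * Θ ‖(collide ω (v, 0)).1‖) ∂sphereMeasure =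
      2 * π * ⟪a, n⟫_ℝ * ∫ x in (-1:ℝ)..1,
        max (‖v‖ * x - 0) 0 * (‖v‖ - (‖v‖ * x - 0) * x) * Θ (√(‖v‖ ^ 2 - (‖v‖ * x) ^ 2 + 0 ^ 2)) := by
    rw [← sphereIntegral_dipole_slice_eq a hΘ hm hn hvn 0]
    refine integral_congr_ae (Eventually.of_forall fun ω => ?_)
    dsimp only
    rw [hardSphereKernel_mul_dipole_collide_fst, inner_zero_left]
  have h4 : (∫ x in (-1:ℝ)..1, max (‖v‖ * x - 0) 0 * (‖v‖ - (‖v‖ * x - 0) * x) * Θ (√(‖v‖ ^ 2 - (‖v‖ * x) ^ 2 + 0 ^ 2))) =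
      ∫ x in (-1:ℝ)..1, max (‖v‖ * x) 0 * (‖v‖ - ‖v‖ * x * x) * Θ (√(‖v‖ ^ 2 - (‖v‖ * x) ^ 2)) := by
    simp only [sub_zero, ne_eq, OfNat.ofNat_ne_zero, not_false_eq_true, zero_pow, add_zero]
  rw [h4] at h3
  simp only at h0 h1
  linarith

/-- **The (e-K₂) difference on dipole fields in slice form**: for `Θ` measurable and bounded on `[0, ∞)`, unit `n`
with `⟪v, ·⟫ = ‖v‖⟪n, ·⟫`, `S = ‖v‖`, `u = ⟪a, ·⟫ Θ(‖·‖)`: `gainTerm u v - lorentzGain u v = 4π ⟪a, n⟫ ∫ γ(dt) (J(t) - J(0))`,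
`J(t) = ∫_{-1}^{1} (S x - t)₊ (S - (S x - t) x) Θ(√(S² - (S x)² + t²)) dx`. [folklore] -/
theorem gainTerm_sub_lorentzGain_dipole_eq (a : EuclideanSpace ℝ (Fin 3)) (hΘ : Measurable Θ)
    (hm : ∀ t : ℝ, 0 ≤ t → |Θ t| ≤ m) {n : EuclideanSpace ℝ (Fin 3)} (hn : ‖n‖ = 1)
    (hvn : ∀ x : EuclideanSpace ℝ (Fin 3), ⟪v, x⟫_ℝ = ‖v‖ * ⟪n, x⟫_ℝ) :
    gainTerm (fun x => ⟪a, x⟫_ℝ * Θ ‖x‖) v - lorentzGain (fun x => ⟪a, x⟫_ℝ * Θ ‖x‖) v =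
      4 * π * ⟪a, n⟫_ℝ * ∫ t, ((∫ x in (-1:ℝ)..1,
          max (‖v‖ * x - t) 0 * (‖v‖ - (‖v‖ * x - t) * x) * Θ (√(‖v‖ ^ 2 - (‖v‖ * x) ^ 2 + t ^ 2))) -
        ∫ x in (-1:ℝ)..1, max (‖v‖ * x) 0 * (‖v‖ - ‖v‖ * x * x) * Θ (√(‖v‖ ^ 2 - (‖v‖ * x) ^ 2))) ∂gaussianReal 0 1 := by
  rw [gainTerm_dipole_eq_slice a hΘ hm hn hvn, lorentzGain_dipole_eq_slice a hΘ hm hn hvn,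
    integral_sub (integrable_dipole_slice hΘ hm v) (integrable_const _), integral_const, probReal_univ, one_smul]
  ring

/-! ### Registered helper -/

/-- **Registered helper `t12_gainTerm_dipole_slice` — the exact one-dimensional (Carleman slice) representation
of the true gain term on a DIPOLE field.** For `a ∈ ℝ³`, `Θ : ℝ → ℝ` measurable with `|Θ t| ≤ m` for `t ≥ 0`
(bounded amplitude), a unit vector `n` and `0 ≤ S` (`M = stdGaussian`, `σ` the surface measure of `S²`,
`(v', w') = collide ω (v, w)`, `γ = gaussianReal 0 1`, `u(x) = ⟪a, x⟫ Θ(‖x‖)`):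
`gainTerm u (S n) = ∫ dM(w) ∫_{S²} ((Sn-w)·ω)₊ u(v') dσ + ∫ dM(w) ∫_{S²} ((Sn-w)·ω)₊ u(w') dσ`
`= 4π ⟪a, n⟫ ∫ γ(dt) ∫_{-1}^{1} (S x - t)₊ (S - (S x - t) x) Θ(√(S² - (S x)² + t²)) dx`.
Mechanism: exchange symmetry (`gainFst_eq_gainSnd`: twice the own piece); Carleman's slice — with `p = ⟪v, ω⟫ = S x`,
`t = ⟪w, ω⟫` the own particle has flux `(p - t)₊`, speed `√(S² - p² + t²)` AND `⟪a, v'⟫ = ⟪a, v⟫ - (p - t)⟪a, ω⟫`, all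
through `t` only; `t ∼ γ` under the Maxwellian for every `ω` (`stdGaussian_map_inner_sphere`); hat-box for the height
`x = ⟪n, ω⟫` and Funk–Hecke for `P₁` (`integral_sphere_zonal_mul_inner`) for the factor `⟪a, ω⟫`. The Lorentz
operator is the slice `t = 0` (`lorentzGain_dipole_eq_slice`, `= (4π/S²)⟪a, n⟫∫₀^S r³ Θ(r) dr`, the `ℓ = 1` Euler
kernel of plan §5), so (e-K₂) on the dipole sector is the one-dimensional law comparison `∫ γ(dt) (J(t) - J(0))`
(`gainTerm_sub_lorentzGain_dipole_eq`; estimate in the sibling file `…T12GainDipoleB`). [folklore] -/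
theorem t12_gainTerm_dipole_slice : ∀ (a : EuclideanSpace ℝ (Fin 3)) (Θ : ℝ → ℝ) (m : ℝ), Measurable Θ → (∀ t : ℝ, 0 ≤ t → |Θ t| ≤ m) → ∀ n : EuclideanSpace ℝ (Fin 3), ‖n‖ = 1 → ∀ S : ℝ, 0 ≤ S → Summit.AtomisticToContinuum.HydrodynamicLimit.Theorems.ClampedCorrectorBirth.gainTerm (fun x : EuclideanSpace ℝ (Fin 3) => inner ℝ a x * Θ ‖x‖) (S • n) = 4 * Real.pi * inner ℝ a n * ∫ t, (∫ x in (-1:ℝ)..1, max (S * x - t) 0 * (S - (S * x - t) * x) * Θ (Real.sqrt (S ^ 2 - (S * x) ^ 2 + t ^ 2))) ∂ProbabilityTheory.gaussianReal 0 1 := by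
  intro a Θ m hΘ hm n hn S hS
  have hS' : ‖S • n‖ = S := by rw [norm_smul, Real.norm_eq_abs, abs_of_nonneg hS, hn, mul_one]
  have hvn : ∀ x : EuclideanSpace ℝ (Fin 3), ⟪S • n, x⟫_ℝ = ‖S • n‖ * ⟪n, x⟫_ℝ := fun x => by
    rw [real_inner_smul_left, hS']
  have h := gainTerm_dipole_eq_slice a hΘ hm hn hvn
  rwa [hS'] at h

end Summit.AtomisticToContinuum.HydrodynamicLimit.Theorems.ClampedCorrectorBirth

end
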